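import Literature.Algebra.Homology.UnramifiedClassModule
import Literature.Algebra.Homology.TateCohomologyFiniteCyclic
import HarnessLib

/-!
# No Tate–Nakayama duality with FINITE coefficients for a class MODULE (finite level):
# the class module `(ℤ/2, ℤ)` and `M = ℤ/2` (Harari, *Galois Cohomology and Class Field Theory*,
# Thm. 16.21 with Remark 16.3 and Example 16.23; Serre, *Local Fields* XI §3 / IX §8)

Topic `Algebra/Homology`; namespace `Literature.Algebra.Homology` (sub-namespace
`ClassModuleNoFiniteDuality`).  Theorems only (no definition, no instance, no named fact, no
`sorry`); imports the tree's `UnramifiedClassModule` (Neukirch II §4: the class module of an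
unramified layer, `Unramified.IsUnramified σ A v ϖ ⟹ IsClassModule A (c · ϖ)`) and
`TateCohomologyFiniteCyclic` (Serre VIII §4: `Ĥⁿ` of a finite cyclic group in every degree).
Cell `bsd-schneider-ideate`, seat `door-c3` gen 13: a kernel-checked OBSTRUCTION for the planned
Route-A brick «G5b» of FINDING-door-c4-g11 §5 / FINDING-door-c6-g7 §5 (A2″) («the finite-coefficient
duality `Ĥ^r(G, Hom(M, C)) × Ĥ^{2−r}(G, M) → H²(G, C) ≅ ℤ/|G|` perfect for finite `M`, degrees
`0–2`, for a class module `C` at a finite layer»).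

What the print says.  Tate's duality theorem for a class formation (Harari Thm. 16.21 = Milne
*ADT* I Thm. 1.8) is a statement about a PROFINITE group `G` and a formation module
`C = lim C^U` with `inv_U : H²(U, C) ≅ ℚ/ℤ` for every open `U` — so `|G|` is divisible by every
integer (Harari Remark 16.3) and NO finite group carries a class formation in that sense; it is
phrased with `Ext^r_G(M, C)`, not with `H^r(G, Hom(M, C))`; for `M` f.g. ℤ-FREE it gives
`α^r : Ext^r_G(M, C) ≅ H^{2−r}(G, M)^*` for `r ≥ 1` ((a)), and for FINITE `M` the degrees `r = 1`
and `r = 0` hold only under the extra hypotheses (b) `α¹(U, ℤ/m)` bijective and (c)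
`α⁰(U, ℤ/m)` surjective/bijective for all open `U` and all `m` — arithmetic inputs (reciprocity map
and existence theorem for `C^U`), verified for `(G_S, C_S)` in Harari §17.  At a FINITE layer the
engine's Lang class module `IsClassModule A φ` (`H¹(U, A) = 0`, `H²(U, A)` cyclic of order `|U|`)
supports the ℤ-free Tate–Nakayama isomorphism (Harari Prop. 16.6; the tree's `TateTheorem`) but NOT
a finite-coefficient duality, as the following two-line example shows.

The example.  `G = ℤ/2` (written `Multiplicative (ZMod 2)`), `C = ℤ` with the trivial action —
a class module: `H¹(U, ℤ) = Hom(U, ℤ) = 0`, `H²(U, ℤ) ≅ Hom(U, ℚ/ℤ)` cyclic of order `|U|`;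
in the tree it is the unramified layer with valuation `v = id` and prime element `ϖ = 1` (its units
`ker v = 0` are cohomologically trivial), fundamental class the carry cocycle (Harari Example
16.5 (b) / 16.23 (a) at one finite layer).  `M = ℤ/2` with the trivial action.  Then
`Hom_ℤ(M, C) = Hom(ℤ/2, ℤ) = 0`, so `Ĥ^r(G, Hom(M, C)) = H^r(G, Hom(M, C)) = 0` for EVERY `r`,
while `Ĥ^s(G, M) ≅ ℤ/2` for every `s ∈ ℤ` and `H^s(G, M) ≅ ℤ/2` for every `s ≥ 0` (finite cyclic
group, trivial coefficients killed by `|G|`).  Hence no pairing whatsoever between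
`Ĥ^r(G, Hom(M, C))` and `Ĥ^{2−r}(G, M)` (cup product or not, Tate or ordinary cohomology, any degree
matching) is perfect, and `Ĥ^r(G, Hom(M, C))` is never in bijection with the Pontryagin dual of
`Ĥ^{2−r}(G, M)`: the cardinalities are `1` and `2`.

## What is formalised

* §1 (`G` finite with a generator `σ`) `isUnramified_trivial_int σ hσ : Unramified.IsUnramified σ
  (Rep.trivial ℤ G ℤ) (𝟙 _) 1` and **`isClassModule_trivial_int`**: `(G, ℤ_triv)` is a class module
  with fundamental class the Frobenius (= carry) cocycle.
* §2 (private plumbing: `Hom(V, W) = 0` for finite `V`, torsion-free `W`) `isZero_ihom_trivial_int`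
  (`Hom(M, ℤ_triv) = 0` in `Rep ℤ G` for `M` with finite carrier), and its cohomology:
  `isZero_groupCohomology_ihom_trivial_int`, `isZero_tateCohomology_ihom_trivial_int`,
  `natCard_…_eq_one` (both, every degree).
* §3 (`G` finite cyclic) **`natCard_tateCohomology_trivial_zmod_card`**:
  `|Ĥⁿ(G, ℤ/|G|)| = |G|` for every `n ∈ ℤ`; **`natCard_groupCohomology_trivial_zmod_card`**: the same
  for `Hⁿ`, every `n ≥ 0`.
* §4 The example `G = ℤ/2`, `C = ℤ`, `M = ℤ/2` assembled (`natCard_tateCohomology_ihom_C2`,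
  `natCard_tateCohomology_C2`, …) and the OBSTRUCTIONS
  **`not_natCard_tateCohomology_ihom_eq_of_isClassModule`** and
  **`not_natCard_groupCohomology_ihom_eq_of_isClassModule`**: it is FALSE that for every finite
  group `G`, every class module `(C, φ)` over `ℤ`, every `M : Rep ℤ G` with finite carrier and all
  degrees `r + s = 2`, `|Ĥ^r(G, Hom(M, C))| = |Ĥ^s(G, M)|` (resp. `|H^r| = |H^s|`).

HONEST FRAMING: an elementary counterexample to a PLANNED engine statement, recorded so that Route A
(toward Poitou–Tate for `ControlFacts` (i)) formulates its duality step at the profinite level with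
`Ext` (Harari Thm. 16.21 / §17), not at finite layers; nothing here is new mathematics and nothing
is asserted about number fields or BSD.

## References
* D. Harari, *Galois Cohomology and Class Field Theory*, Universitext, Springer (2020), §16.1
  Def. 16.1, Remark 16.3, Example 16.5, Prop. 16.6; §16.3 Lemmas 16.19–16.20, Thm. 16.21,
  Remark 16.22, Example 16.23; §16.4; §17.1–17.3. [Harari2020]
* J. S. Milne, *Arithmetic Duality Theorems*, 2nd ed. (2006), I §1 (Thm. 1.8), I §4. [MilneADT2006]
* J.-P. Serre, *Local Fields*, GTM 67 (1979), IX §8, XI §3. [Serre1979]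
* J. Neukirch, *Class Field Theory — The Bonn Lectures* (2013), II §4 Thm. (4.6). [Neukirch2013]
-/

noncomputable section

open CategoryTheory CategoryTheory.Limits groupCohomology

universe u v

namespace Literature.Algebra.Homology

namespace ClassModuleNoFiniteDuality

/-! ## §1 The class module `(G, ℤ_triv)` of a finite cyclic group (unramified layer with `v = id`, `ϖ = 1`) -/

section ClassModule

variable {G : Type} [Group G] (σ : G) (hσ : ∀ x, x ∈ Subgroup.zpowers σ)

/-- A representation with (sub)singleton carrier is a zero object of `Rep k G`. [folklore] -/
private theorem isZero_of_subsingleton {k H : Type u} [CommRing k] [Group H] (X : Rep.{u} k H)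
    [Subsingleton X] : IsZero X :=
  (IsZero.iff_id_eq_zero X).2
    (Rep.hom_ext (Representation.IntertwiningMap.ext (LinearMap.ext fun _ => Subsingleton.elim _ _)))

/-- The units `ker (id : ℤ → ℤ) = 0` of the layer `(G, ℤ, v = id)` form a zero object.
[cite: Neukirch2013, II §4 Thm. (4.3)] -/
theorem isZero_kerRep_id : IsZero (Herbrand.kerRep (𝟙 (Rep.trivial ℤ G ℤ))) := by
  haveI : Subsingleton (Herbrand.kerRep (𝟙 (Rep.trivial ℤ G ℤ))) := by
    refine ⟨fun a b => Subtype.ext ?_⟩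
    have ha : (a : ℤ) = 0 := LinearMap.mem_ker.1 a.2
    have hb : (b : ℤ) = 0 := LinearMap.mem_ker.1 b.2
    rw [ha, hb]
  exact isZero_of_subsingleton _

include hσ in
/-- **`(G, ℤ_triv)` is an unramified layer in the tree's sense** — generator `σ`, valuation
`v = id : ℤ → ℤ` (units `0`, cohomologically trivial), prime element `ϖ = 1` (Harari Example 16.5 (b)
at ONE finite layer: `Ĝ ↠ G` cyclic acting trivially on `ℤ`).
[cite: Harari2020, §16.1 Example 16.5 (b)] [cite: Neukirch2013, II §4 Thm. (4.6)] -/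
theorem isUnramified_trivial_int :
    Unramified.IsUnramified σ (Rep.trivial ℤ G ℤ) (𝟙 (Rep.trivial ℤ G ℤ)) (1 : ℤ) where
  mem_zpowers := hσ
  isCohomologicallyTrivial :=
    CohomologicallyTrivial.isCohomologicallyTrivial_of_isZero (isZero_kerRep_id (G := G))
  ρ_apply g := by simp
  map_eq_one := rfl

/-- **The class module `(G, ℤ_triv)`**: for a finite cyclic group `G = ⟨σ⟩` acting trivially on `ℤ`,
`H¹(U, ℤ) = 0` and `H²(U, ℤ)` is cyclic of order `|U|` for every subgroup `U`, with fundamental class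
the Frobenius (carry) cocycle of `σ` — `IsClassModule` in Lang's sense (the tree's `TateTheorem`
applies). [cite: Harari2020, §16.1 Example 16.5 (b)] [cite: Neukirch2013, II §4 Thm. (4.6)]
[cite: Lang1996, III §3] -/
theorem isClassModule_trivial_int [Fintype G] :
    IsClassModule (Rep.trivial ℤ G ℤ) (isUnramified_trivial_int σ hσ).cocycle :=
  (isUnramified_trivial_int σ hσ).isClassModule

end ClassModule

/-! ## §2 `Hom(M, ℤ_triv) = 0` for `M` with finite carrier, and its cohomology -/

section HomZero

/-- `Hom(V, W) = 0` for a finite abelian group `V` and a torsion-free `W` (every element of `V` has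
finite order). [folklore] -/
private theorem addMonoidHom_eq_zero_of_finite {V : Type u} {W : Type v} [AddCommGroup V] [Finite V]
    [AddCommGroup W] [NoZeroSMulDivisors ℕ W] (f : V →+ W) : f = 0 := by
  ext x
  have h1 : addOrderOf x • f x = 0 := by rw [← map_nsmul, addOrderOf_nsmul_eq_zero, map_zero]
  exact (smul_eq_zero.1 h1).resolve_left (addOrderOf_pos x).ne'

/-- `Hom_ℤ(V, W)` is a singleton for finite `V` and torsion-free `W`, for ANY `ℤ`-module structures
(the ones carried by objects of `Rep ℤ G` need not be the canonical ones definitionally). [folklore] -/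
private theorem subsingleton_linearMap_of_finite (V : Type u) (W : Type v) [AddCommGroup V] [Module ℤ V]
    [Finite V] [AddCommGroup W] [Module ℤ W] [NoZeroSMulDivisors ℕ W] :
    Subsingleton (V →ₗ[ℤ] W) :=
  ⟨fun f g => LinearMap.toAddMonoidHom_injective (by
    rw [addMonoidHom_eq_zero_of_finite f.toAddMonoidHom,
      addMonoidHom_eq_zero_of_finite g.toAddMonoidHom])⟩

variable {G : Type} [Group G] (M : Rep.{0} ℤ G) [Finite M]

/-- **`Hom(M, ℤ_triv) = 0` in `Rep ℤ G`** (Mathlib's internal hom `(Rep.ihom M).obj ℤ_triv`, carrier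
`M →ₗ[ℤ] ℤ` with the conjugation action) whenever the carrier of `M` is finite.
[cite: Harari2020, §16.3 (proof of Lemma 16.20: `Hom(M, C) ≅ Hom(M, ℤ) ⊗ C`)] -/
theorem isZero_ihom_trivial_int : IsZero ((Rep.ihom M).obj (Rep.trivial ℤ G ℤ)) := by
  haveI : Subsingleton ((Rep.ihom M).obj (Rep.trivial ℤ G ℤ)) := by
    rw [Rep.ihom_obj_V]
    exact @subsingleton_linearMap_of_finite _ _ _ M.hV2 _ _ _ _
  exact isZero_of_subsingleton _

/-- `Hⁿ(G, Hom(M, ℤ_triv)) = 0` for every `n ≥ 0`. [cite: Harari2020, §16.3 Thm. 16.21 (context)] -/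
theorem isZero_groupCohomology_ihom_trivial_int (n : ℕ) :
    IsZero (groupCohomology ((Rep.ihom M).obj (Rep.trivial ℤ G ℤ)) n) :=
  (groupCohomology.functor ℤ G n).map_isZero (isZero_ihom_trivial_int M)

/-- `|Hⁿ(G, Hom(M, ℤ_triv))| = 1` for every `n ≥ 0`. [cite: Harari2020, §16.3 Thm. 16.21 (context)] -/
theorem natCard_groupCohomology_ihom_trivial_int_eq_one (n : ℕ) :
    Nat.card (groupCohomology ((Rep.ihom M).obj (Rep.trivial ℤ G ℤ)) n) = 1 := by
  haveI := ModuleCat.subsingleton_of_isZero (isZero_groupCohomology_ihom_trivial_int M n)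
  exact Nat.card_of_subsingleton 0

variable [Fintype G]

/-- `Ĥⁿ(G, Hom(M, ℤ_triv)) = 0` for every `n ∈ ℤ` (`G` finite). [cite: Harari2020, §16.3 Thm. 16.21 (context)] -/
theorem isZero_tateCohomology_ihom_trivial_int (n : ℤ) :
    IsZero (tateCohomology ((Rep.ihom M).obj (Rep.trivial ℤ G ℤ)) n) :=
  (tateCohomologyFunctor n).map_isZero (isZero_ihom_trivial_int M)

/-- `|Ĥⁿ(G, Hom(M, ℤ_triv))| = 1` for every `n ∈ ℤ`. [cite: Harari2020, §16.3 Thm. 16.21 (context)] -/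
theorem natCard_tateCohomology_ihom_trivial_int_eq_one (n : ℤ) :
    Nat.card (tateCohomology ((Rep.ihom M).obj (Rep.trivial ℤ G ℤ)) n) = 1 := by
  haveI := ModuleCat.subsingleton_of_isZero (isZero_tateCohomology_ihom_trivial_int M n)
  exact Nat.card_of_subsingleton 0

end HomZero

/-! ## §3 `|Ĥⁿ(G, ℤ/|G|)| = |Hⁿ(G, ℤ/|G|)| = |G|` for a finite cyclic group and trivial action -/

section Cyclic

variable {G : Type} [CommGroup G] [Fintype G] [DecidableEq G] (g : G)
  (hg : ∀ x, x ∈ Subgroup.zpowers g)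

omit [CommGroup G] [DecidableEq G] in
/-- `|G| · x = 0` in `ℤ/|G|` (plumbing). [folklore] -/
private theorem card_zsmul_zmod (x : ZMod (Fintype.card G)) : (Fintype.card G : ℤ) • x = 0 := by
  rw [zsmul_eq_mul, Int.cast_natCast, ZMod.natCast_self, zero_mul]

include hg in
/-- **Finite cyclic `G`, trivial coefficients `ℤ/|G|`: `|Ĥⁿ(G, ℤ/|G|)| = |G|` for EVERY `n ∈ ℤ`**
(`Ĥ^even = V/|G|V = V`, `Ĥ^odd = V[|G|] = V` for `V = ℤ/|G|`).
[cite: Serre1979, VIII §4 Prop. 6 Corollary] -/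
theorem natCard_tateCohomology_trivial_zmod_card (n : ℤ) :
    Nat.card (tateCohomology (Rep.trivial ℤ G (ZMod (Fintype.card G))) n) = Fintype.card G := by
  rcases Int.even_or_odd n with hn | hn
  · rw [Nat.card_congr (FiniteCyclic.tateCohomologyIsoEvenOfIsTrivial
      (Rep.trivial ℤ G (ZMod (Fintype.card G))) g hg n hn).toLinearEquiv.toEquiv]
    change Nat.card (ZMod (Fintype.card G) ⧸ LinearMap.range ((Fintype.card G : ℤ) •
      (LinearMap.id : ZMod (Fintype.card G) →ₗ[ℤ] ZMod (Fintype.card G)))) = _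
    have hbot : LinearMap.range ((Fintype.card G : ℤ) •
        (LinearMap.id : ZMod (Fintype.card G) →ₗ[ℤ] ZMod (Fintype.card G))) = ⊥ := by
      rw [LinearMap.range_eq_bot]
      ext x
      simp only [LinearMap.smul_apply, LinearMap.id_coe, id_eq, LinearMap.zero_apply]
      exact card_zsmul_zmod (G := G) x
    rw [Nat.card_congr (Submodule.quotEquivOfEqBot _ hbot).toEquiv]
    exact Nat.card_zmod _
  · rw [Nat.card_congr (FiniteCyclic.tateCohomologyIsoOddOfIsTrivial
      (Rep.trivial ℤ G (ZMod (Fintype.card G))) g hg n hn).toLinearEquiv.toEquiv]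
    change Nat.card (Submodule.torsionBy ℤ (ZMod (Fintype.card G)) (Fintype.card G : ℤ)) = _
    have htop : Submodule.torsionBy ℤ (ZMod (Fintype.card G)) (Fintype.card G : ℤ) = ⊤ := by
      rw [eq_top_iff]
      intro x _
      rw [Submodule.mem_torsionBy_iff]
      exact card_zsmul_zmod (G := G) x
    rw [htop, Nat.card_congr (Submodule.topEquiv (R := ℤ) (M := ZMod (Fintype.card G))).toEquiv]
    exact Nat.card_zmod _

include hg in
/-- **Finite cyclic `G`, trivial coefficients `ℤ/|G|`: `|Hⁿ(G, ℤ/|G|)| = |G|` for every `n ≥ 0`**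
(`H⁰ = V`; `Hⁿ = Ĥⁿ` for `n ≥ 1`). [cite: Serre1979, VIII §4 Prop. 6 Corollary] -/
theorem natCard_groupCohomology_trivial_zmod_card (n : ℕ) :
    Nat.card (groupCohomology (Rep.trivial ℤ G (ZMod (Fintype.card G))) n) = Fintype.card G := by
  rcases Nat.eq_zero_or_pos n with rfl | hn
  · rw [Nat.card_congr (groupCohomology.H0IsoOfIsTrivial
      (Rep.trivial ℤ G (ZMod (Fintype.card G)))).toLinearEquiv.toEquiv]
    exact Nat.card_zmod _
  · haveI : NeZero n := ⟨hn.ne'⟩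
    have e : (tateCohomology (Rep.trivial ℤ G (ZMod (Fintype.card G))) n : Type) ≃
        (groupCohomology (Rep.trivial ℤ G (ZMod (Fintype.card G))) n : Type) :=
      ((TateCohomology.isoGroupCohomology n).app
        (Rep.trivial ℤ G (ZMod (Fintype.card G)))).toLinearEquiv.toEquiv
    rw [← Nat.card_congr e]
    exact natCard_tateCohomology_trivial_zmod_card g hg n

end Cyclic

/-! ## §4 The example `G = ℤ/2`, `C = ℤ_triv`, `M = ℤ/2`, and the obstruction -/

section Example

/-- `ℤ/2 = ⟨1⟩` (multiplicative notation). [folklore] -/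
private theorem mem_zpowers_ofAdd_one (x : Multiplicative (ZMod 2)) :
    x ∈ Subgroup.zpowers (Multiplicative.ofAdd (1 : ZMod 2)) := by
  refine Subgroup.mem_zpowers_iff.2 ⟨((Multiplicative.toAdd x).val : ℤ), ?_⟩
  rw [← ofAdd_zsmul, zsmul_eq_mul, mul_one, Int.cast_natCast, ZMod.natCast_zmod_val, ofAdd_toAdd]

/-- `|ℤ/2| = 2` (plumbing). [folklore] -/
private theorem card_C2 : Fintype.card (Multiplicative (ZMod 2)) = 2 := by
  rw [Fintype.card_multiplicative, ZMod.card]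

/-- **The class module of the example**: `(ℤ/2, ℤ_triv)` with the carry cocycle of the generator
`1`. [cite: Harari2020, §16.1 Example 16.5 (b)] [cite: Neukirch2013, II §4 Thm. (4.6)] -/
theorem isClassModule_C2 :
    IsClassModule (Rep.trivial ℤ (Multiplicative (ZMod 2)) ℤ)
      (isUnramified_trivial_int (Multiplicative.ofAdd (1 : ZMod 2)) mem_zpowers_ofAdd_one).cocycle :=
  isClassModule_trivial_int (Multiplicative.ofAdd (1 : ZMod 2)) mem_zpowers_ofAdd_one

/-- `|Ĥⁿ(ℤ/2, Hom(ℤ/2, ℤ))| = 1` for every `n ∈ ℤ`. [cite: Harari2020, §16.3 Thm. 16.21 (context)] -/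
theorem natCard_tateCohomology_ihom_C2 (n : ℤ) :
    Nat.card (tateCohomology ((Rep.ihom (Rep.trivial ℤ (Multiplicative (ZMod 2)) (ZMod 2))).obj
      (Rep.trivial ℤ (Multiplicative (ZMod 2)) ℤ)) n) = 1 :=
  natCard_tateCohomology_ihom_trivial_int_eq_one _ n

/-- `|Ĥⁿ(ℤ/2, ℤ/2)| = 2` for every `n ∈ ℤ`. [cite: Serre1979, VIII §4 Prop. 6 Corollary] -/
theorem natCard_tateCohomology_C2 (n : ℤ) :
    Nat.card (tateCohomology (Rep.trivial ℤ (Multiplicative (ZMod 2)) (ZMod 2)) n) = 2 := by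
  have h := natCard_tateCohomology_trivial_zmod_card (Multiplicative.ofAdd (1 : ZMod 2))
    mem_zpowers_ofAdd_one n
  rw [card_C2] at h
  exact h

/-- `|Hⁿ(ℤ/2, Hom(ℤ/2, ℤ))| = 1` for every `n ≥ 0`. [cite: Harari2020, §16.3 Thm. 16.21 (context)] -/
theorem natCard_groupCohomology_ihom_C2 (n : ℕ) :
    Nat.card (groupCohomology ((Rep.ihom (Rep.trivial ℤ (Multiplicative (ZMod 2)) (ZMod 2))).obj
      (Rep.trivial ℤ (Multiplicative (ZMod 2)) ℤ)) n) = 1 :=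
  natCard_groupCohomology_ihom_trivial_int_eq_one _ n

/-- `|Hⁿ(ℤ/2, ℤ/2)| = 2` for every `n ≥ 0`. [cite: Serre1979, VIII §4 Prop. 6 Corollary] -/
theorem natCard_groupCohomology_C2 (n : ℕ) :
    Nat.card (groupCohomology (Rep.trivial ℤ (Multiplicative (ZMod 2)) (ZMod 2)) n) = 2 := by
  have h := natCard_groupCohomology_trivial_zmod_card (Multiplicative.ofAdd (1 : ZMod 2))
    mem_zpowers_ofAdd_one n
  rw [card_C2] at h
  exact h

/-- **OBSTRUCTION (Tate cohomology).**  It is FALSE that for every finite group `G`, every class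
module `(C, φ)` over `ℤ` (Lang: `H¹(U, C) = 0`, `H²(U, C)` cyclic of order `|U|`), every `G`-module
`M` with finite carrier and all degrees `r + s = 2`, the finite groups `Ĥ^r(G, Hom(M, C))` and
`Ĥ^s(G, M)` have the same cardinality — so no pairing `Ĥ^r(G, Hom(M, C)) × Ĥ^{2−r}(G, M) → H²(G, C)`
is perfect in general at a finite layer, and `Ĥ^r(G, Hom(M, C))` is not in bijection with the dual
of `Ĥ^{2−r}(G, M)`.  Witness: `G = ℤ/2`, `C = ℤ_triv`, `M = ℤ/2`, any `r` (cards `1` vs `2`).  The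
printed duality (Harari Thm. 16.21) is for a PROFINITE class formation with `Ext^r_G(M, C)` and,
for finite `M` in degrees `0, 1`, under hypotheses (b)–(c).
[cite: Harari2020, §16.3 Thm. 16.21, Remark 16.3 and Example 16.23] [cite: MilneADT2006, I Thm. 1.8]
[cite: Serre1979, IX §8] -/
theorem not_natCard_tateCohomology_ihom_eq_of_isClassModule :
    ¬ ∀ (G : Type) [Group G] [Fintype G] (C : Rep.{0} ℤ G) (φ : cocycles₂ C),
        IsClassModule C φ → ∀ (M : Rep.{0} ℤ G), Finite M → ∀ (r s : ℤ), r + s = 2 →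
          Nat.card (tateCohomology ((Rep.ihom M).obj C) r) = Nat.card (tateCohomology M s) := by
  intro h
  have h1 := h (Multiplicative (ZMod 2)) (Rep.trivial ℤ (Multiplicative (ZMod 2)) ℤ) _
    isClassModule_C2 (Rep.trivial ℤ (Multiplicative (ZMod 2)) (ZMod 2)) inferInstance 1 1 (by norm_num)
  rw [natCard_tateCohomology_ihom_C2, natCard_tateCohomology_C2] at h1
  exact absurd h1 (by norm_num)

/-- **OBSTRUCTION (ordinary cohomology; the degrees `(1,1)`, `(0,2)`, `(2,0)` of the planned
brick).**  It is FALSE that for every finite group `G`, every class module `(C, φ)` over `ℤ`, every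
`G`-module `M` with finite carrier and all `r + s = 2`, `|H^r(G, Hom(M, C))| = |H^s(G, M)|`.
Witness: `G = ℤ/2`, `C = ℤ_triv`, `M = ℤ/2` (cards `1` vs `2` in every degree).
[cite: Harari2020, §16.3 Thm. 16.21, Remark 16.3 and Example 16.23] [cite: MilneADT2006, I Thm. 1.8]
[cite: Serre1979, IX §8] -/
theorem not_natCard_groupCohomology_ihom_eq_of_isClassModule :
    ¬ ∀ (G : Type) [Group G] [Fintype G] (C : Rep.{0} ℤ G) (φ : cocycles₂ C),
        IsClassModule C φ → ∀ (M : Rep.{0} ℤ G), Finite M → ∀ (r s : ℕ), r + s = 2 →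
          Nat.card (groupCohomology ((Rep.ihom M).obj C) r) = Nat.card (groupCohomology M s) := by
  intro h
  have h1 := h (Multiplicative (ZMod 2)) (Rep.trivial ℤ (Multiplicative (ZMod 2)) ℤ) _
    isClassModule_C2 (Rep.trivial ℤ (Multiplicative (ZMod 2)) (ZMod 2)) inferInstance 1 1 (by norm_num)
  rw [natCard_groupCohomology_ihom_C2, natCard_groupCohomology_C2] at h1
  exact absurd h1 (by norm_num)

/-- **The example in one line** (for citation by the Route-A planners): a finite group, a class
module over `ℤ` and a finite module for which EVERY `Ĥ^r(G, Hom(M, C))` is trivial while EVERY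
`Ĥ^s(G, M)` and every `H^s(G, M)` has two elements.
[cite: Harari2020, §16.3 Thm. 16.21, Remark 16.3 and Example 16.23] -/
theorem exists_isClassModule_finite_natCard_ne :
    ∃ (G : Type) (_ : Group G) (_ : Fintype G) (C : Rep.{0} ℤ G) (φ : cocycles₂ C)
      (_ : IsClassModule C φ) (M : Rep.{0} ℤ G) (_ : Finite M),
      (∀ r : ℤ, Nat.card (tateCohomology ((Rep.ihom M).obj C) r) = 1) ∧
      (∀ r : ℕ, Nat.card (groupCohomology ((Rep.ihom M).obj C) r) = 1) ∧
      (∀ s : ℤ, Nat.card (tateCohomology M s) = 2) ∧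
      (∀ s : ℕ, Nat.card (groupCohomology M s) = 2) :=
  ⟨Multiplicative (ZMod 2), inferInstance, inferInstance, Rep.trivial ℤ _ ℤ, _, isClassModule_C2,
    Rep.trivial ℤ _ (ZMod 2), inferInstance, natCard_tateCohomology_ihom_C2,
    natCard_groupCohomology_ihom_C2, natCard_tateCohomology_C2, natCard_groupCohomology_C2⟩

end Example

end ClassModuleNoFiniteDuality

end Literature.Algebra.Homology

end
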